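import Summits.Ventures.YMGap.RobustBall.ScreenedStabilityStar
import HarnessLib

/-!
# Venture YMGap, track ROBUST-BALL (Y2) — THROUGH THE STAR DOOR: CONNECTED CORRELATIONS ARE LIPSCHITZ IN THE ACTION, for every tier-1 member
# with a star window bound (the `SU(2)` Wilson point up to `β_W = 1/3`)

HONEST FRAMING. WHAT THIS IS: a venture file (cell `pub-ymgap`, track Y2 ROBUST-BALL, seat rb-p1, theorems only): the STAR-DOOR twin of
`CovarianceLipschitzS.lean`, a corollary of the screened state stability through the star door (`ScreenedStabilityStar.lean`, used with one
level: window loads `≤ B` on every vertex star).  Member `(W, supp)`: continuous own-link terms of range `R`, a star window bound with locality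
radius `D ≥ R + 2` and received sum `0 ≤ ρ < 1` (every star cell of the lane supplies one; `SU(2)` on `ℤ⁴` up to `β_W = 1/3`).
* ★ `abs_cov_sub_cov_le_of_perturbation_star` — modification `(V', suppV')` bounded, adapted, locally listed, of ANY strength, with one-link
  oscillation witnesses of window load `≤ B` on every vertex star; `μ` any DLR state of the member, `μ'` ANY DLR state of `W + V'`; `f`, `g`
  measurable, local on `Δ_f`, `Δ_g`, Frobenius-Lipschitz vectors `δ_f`, `δ_g`:
  `|cov_{μ'}(f, g) − cov_μ(f, g)| ≤ 32N · min(e^{B} − 1, 2)/(1 − ρ) · (Σ_{Δ_f} δ_f)(Σ_{Δ_g} δ_g)`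
  (centring at the unit configuration + three applications of `abs_integral_sub_integral_le_of_perturbation_screened_star`).
This is the per-term input of `SusceptibilityHoelderStar.lean`; the `SU(2)` cells up to `β_W = 1/3` are in `StateTaylorRemainderStar.lean`.
WHAT THIS IS NOT: one-sided (only the member's side contracts); Dobrushin–Shlosman comparison constants at lattice strong coupling; nothing about
the continuum limit or a Clay-sense mass gap.
-/

noncomputable section

open MeasureTheory ProbabilityTheory Function Finset Real
open scoped NNReal
open Literature.Probability.LatticeModels
open Literature.Probability.LatticeModels.DobrushinMetric
open Literature.MathematicalPhysics.QuantumLattice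
open Literature.MathematicalPhysics.QuantumFieldTheory hiding ZdEdge Site
open Summit.Ventures.YMGap.DSWindowZd

namespace Summit.Ventures.YMGap.RobustBall

variable {d N : ℕ}

section Star

variable {W V' : Potential (ZdEdge d) (SUN N)} {supp suppV' : Finset (ZdEdge d) → Finset (Finset (ZdEdge d))}

/-- ★ **CONNECTED CORRELATIONS ARE LIPSCHITZ IN THE ACTION, THROUGH THE STAR DOOR.**  Member `(W, supp)` (continuous own-link terms, `ℓ^∞` range
`R`, star window bound with locality radius `D ≥ R + 2`, received sum `0 ≤ ρ < 1`); modification `(V', suppV')` bounded, adapted, locally listed,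
of ANY strength, with one-link oscillation witnesses `oscV'` of window load `≤ B` on every vertex star (`0 ≤ B`); `μ` any DLR state of the member,
`μ'` ANY DLR state of `W + V'`; `f`, `g` measurable, local on `Δ_f`, `Δ_g`, with Frobenius-Lipschitz vectors `δ_f`, `δ_g`.  Then
`|cov_{μ'}(f, g) − cov_μ(f, g)| ≤ 32N · min(e^{B} − 1, 2)/(1 − ρ) · (Σ_{Δ_f} δ_f) · (Σ_{Δ_g} δ_g)`. -/
theorem abs_cov_sub_cov_le_of_perturbation_star {β ρ B : ℝ} {R D : ℕ}
    (hWc : ∀ X, Continuous (W X)) (hWdep : ∀ X, DependsOn (W X) (↑X : Set (ZdEdge d))) (hsupp : W.IsSupportedBy supp)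
    (hR : ∀ e, ∀ X ∈ supp {e}, e ∈ X → ∀ y ∈ X, ‖e.1 - y.1‖ ≤ (R : ℝ)) (hD : R + 2 ≤ D) (hρ0 : 0 ≤ ρ) (hρ1 : ρ < 1)
    (h : StarWindowBoundZdR d N (perturbedYM (d := d) (fundamentalRep (Fin N)) (N * β) W supp) D ρ suFrobDist)
    (hV' : V'.IsAdapted) (hV'b : ∀ X, ∃ C, ∀ U, |V' X U| ≤ C) (hsuppV' : V'.IsSupportedBy suppV')
    {oscV' : Finset (ZdEdge d) → ZdEdge d → ℝ} (hoscV' : ∀ X, Dobrushin.IsOscBound (V' X) (oscV' X))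
    (hB : 0 ≤ B) (hload : ∀ c : ZdEdge d, windowLoad d suppV' oscV' (starWinZd c) ≤ B)
    {μ μ' : Measure (LGConfig d (SUN N))}
    (hμ : μ ∈ perturbedGibbsMeasures (d := d) (fundamentalRep (Fin N)) (N * β) W supp)
    (hμ' : μ' ∈ perturbedGibbsMeasures (d := d) (fundamentalRep (Fin N)) (N * β) (W + V') (fun Λ => supp Λ ∪ suppV' Λ))
    {f : LGConfig d (SUN N) → ℝ} (hfm : Measurable f) {Δf : Finset (ZdEdge d)}
    (hfdep : DependsOn f (↑Δf : Set (ZdEdge d))) {δf : ZdEdge d → ℝ} (hδf : IsLipBound suFrobDist f δf)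
    {g : LGConfig d (SUN N) → ℝ} (hgm : Measurable g) {Δg : Finset (ZdEdge d)}
    (hgdep : DependsOn g (↑Δg : Set (ZdEdge d))) {δg : ZdEdge d → ℝ} (hδg : IsLipBound suFrobDist g δg) :
    |cov[f, g; μ'] - cov[f, g; μ]| ≤
      32 * N * (min (Real.exp B - 1) 2 / (1 - ρ)) * (∑ y ∈ Δf, δf y) * ∑ y ∈ Δg, δg y := by
  classical
  haveI : SecondCountableTopology (Matrix (Fin N) (Fin N) ℂ) :=
    inferInstanceAs (SecondCountableTopology (Fin N → Fin N → ℂ))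
  haveI : SecondCountableTopology (SUN N) := Topology.IsEmbedding.subtypeVal.secondCountableTopology
  have hμP : IsGibbsMeasure (perturbedYM (d := d) (fundamentalRep (Fin N)) (N * β) W supp) μ := hμ
  have hμ'P : IsGibbsMeasure (perturbedYM (d := d) (fundamentalRep (Fin N)) (N * β) (W + V') (fun Λ => supp Λ ∪ suppV' Λ)) μ' := hμ'
  haveI := hμP.isProbabilityMeasure
  haveI := hμ'P.isProbabilityMeasure
  obtain ⟨Cs, hCs⟩ : ∃ C : ℝ, C = 2 * Real.sqrt N / (1 - ρ) * (2 * min (Real.exp B - 1) 2) := ⟨_, rfl⟩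
  have h1ρ : 0 < 1 - ρ := sub_pos.2 hρ1
  have hm0 : 0 ≤ min (Real.exp B - 1) 2 := le_min (by linarith [Real.add_one_le_exp B]) (by norm_num)
  -- the one-level state-stability bound through the star door
  have hstab : ∀ {h : LGConfig d (SUN N) → ℝ}, Measurable h → ∀ {Δ : Finset (ZdEdge d)},
      DependsOn h (↑Δ : Set (ZdEdge d)) → ∀ {M : ℝ}, (∀ σ, |h σ| ≤ M) → ∀ {δ : ZdEdge d → ℝ}, IsLipBound suFrobDist h δ →
      |(∫ σ, h σ ∂μ) - ∫ σ, h σ ∂μ'| ≤ Cs * ∑ y ∈ Δ, δ y := by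
    intro h' hhm Δ hhdep M hM δ hδ
    have key := abs_integral_sub_integral_le_of_perturbation_screened_star (r := 0) hWc hWdep hsupp hR hD hρ0 hρ1 h hV' hV'b hsuppV'
      hoscV' hB hB (Δ := Δ) hload (fun c _ => hload c) hμ hμ' hhm hM hhdep hδ
    have hfac : min (Real.exp B - 1) 2 + min (Real.exp B - 1) 2 * ρ ^ ⌊max ((0 : ℝ) - 1) 0 / (D + 2 : ℕ)⌋₊ =
        2 * min (Real.exp B - 1) 2 := by
      rw [show max ((0 : ℝ) - 1) 0 = 0 by norm_num, zero_div, Nat.floor_zero, pow_zero, mul_one]; ring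
    rw [hfac, ← hCs] at key
    exact key
  -- bounds of integrals of bounded functions
  have habsint : ∀ (ν : Measure (LGConfig d (SUN N))) [IsProbabilityMeasure ν]
      {h : LGConfig d (SUN N) → ℝ} {M : ℝ}, (∀ σ, |h σ| ≤ M) → |∫ σ, h σ ∂ν| ≤ M := by
    intro ν _ h M hM
    have h1 := norm_integral_le_of_norm_le_const (μ := ν) (f := h) (C := M) (Filter.Eventually.of_forall fun σ => by
      rw [Real.norm_eq_abs]; exact hM σ)
    rwa [Real.norm_eq_abs, probReal_univ, mul_one] at h1
  -- centring at the unit configuration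
  obtain ⟨f₁, hf₁⟩ : ∃ f₁ : LGConfig d (SUN N) → ℝ, f₁ = fun σ => f σ - f 1 := ⟨_, rfl⟩
  obtain ⟨g₁, hg₁⟩ : ∃ g₁ : LGConfig d (SUN N) → ℝ, g₁ = fun σ => g σ - g 1 := ⟨_, rfl⟩
  have hf₁m : Measurable f₁ := hf₁ ▸ hfm.sub measurable_const
  have hg₁m : Measurable g₁ := hg₁ ▸ hgm.sub measurable_const
  have hf₁dep : DependsOn f₁ (↑Δf : Set (ZdEdge d)) := fun σ τ hστ => by simp only [hf₁, hfdep hστ]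
  have hg₁dep : DependsOn g₁ (↑Δg : Set (ZdEdge d)) := fun σ τ hστ => by simp only [hg₁, hgdep hστ]
  have hf₁lip : IsLipBound suFrobDist f₁ δf :=
    ⟨hδf.nonneg, fun y σ τ hστ => by simpa only [hf₁, sub_sub_sub_cancel_right] using hδf.le y σ τ hστ⟩
  have hg₁lip : IsLipBound suFrobDist g₁ δg :=
    ⟨hδg.nonneg, fun y σ τ hστ => by simpa only [hg₁, sub_sub_sub_cancel_right] using hδg.le y σ τ hστ⟩
  obtain ⟨Sf, hSf⟩ : ∃ S : ℝ, S = ∑ y ∈ Δf, δf y := ⟨_, rfl⟩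
  obtain ⟨Sg, hSg⟩ : ∃ S : ℝ, S = ∑ y ∈ Δg, δg y := ⟨_, rfl⟩
  have hSf0 : 0 ≤ Sf := hSf ▸ sum_nonneg fun y _ => hδf.nonneg y
  have hSg0 : 0 ≤ Sg := hSg ▸ sum_nonneg fun y _ => hδg.nonneg y
  have hN0 : (0 : ℝ) ≤ 2 * Real.sqrt N := by positivity
  -- sup bounds by interpolation along the links of the support
  have hMf : ∀ σ, |f₁ σ| ≤ 2 * Real.sqrt N * Sf := fun σ => by
    rw [hf₁, hSf]
    calc |f σ - f 1| ≤ ∑ y ∈ Δf, δf y * suFrobDist (σ y) ((1 : LGConfig d (SUN N)) y) :=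
          abs_sub_le_sum_of_dependsOn hfdep hδf σ 1
      _ ≤ ∑ y ∈ Δf, δf y * (2 * Real.sqrt N) :=
          sum_le_sum fun y _ => mul_le_mul_of_nonneg_left (suFrobDist_le _ _) (hδf.nonneg y)
      _ = 2 * Real.sqrt N * ∑ y ∈ Δf, δf y := by rw [← sum_mul]; ring
  have hMg : ∀ σ, |g₁ σ| ≤ 2 * Real.sqrt N * Sg := fun σ => by
    rw [hg₁, hSg]
    calc |g σ - g 1| ≤ ∑ y ∈ Δg, δg y * suFrobDist (σ y) ((1 : LGConfig d (SUN N)) y) :=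
          abs_sub_le_sum_of_dependsOn hgdep hδg σ 1
      _ ≤ ∑ y ∈ Δg, δg y * (2 * Real.sqrt N) :=
          sum_le_sum fun y _ => mul_le_mul_of_nonneg_left (suFrobDist_le _ _) (hδg.nonneg y)
      _ = 2 * Real.sqrt N * ∑ y ∈ Δg, δg y := by rw [← sum_mul]; ring
  have hMf0 : 0 ≤ 2 * Real.sqrt N * Sf := mul_nonneg hN0 hSf0
  have hMg0 : 0 ≤ 2 * Real.sqrt N * Sg := mul_nonneg hN0 hSg0
  -- the product `f₁ g₁`: measurable, local on `Δf ∪ Δg`, bounded, coordinatewise Lipschitz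
  have hpm : Measurable fun σ => f₁ σ * g₁ σ := hf₁m.mul hg₁m
  have hpdep : DependsOn (fun σ => f₁ σ * g₁ σ) (↑(Δf ∪ Δg) : Set (ZdEdge d)) := fun σ τ hστ => by
    show f₁ σ * g₁ σ = f₁ τ * g₁ τ
    rw [hf₁dep (fun y hy => hστ y (by simp [Finset.mem_coe.1 hy])), hg₁dep (fun y hy => hστ y (by simp [Finset.mem_coe.1 hy]))]
  have hMp : ∀ σ, |f₁ σ * g₁ σ| ≤ 2 * Real.sqrt N * Sf * (2 * Real.sqrt N * Sg) := fun σ => by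
    rw [abs_mul]; exact mul_le_mul (hMf σ) (hMg σ) (abs_nonneg _) hMf0
  have hf₁lip' : IsLipBound suFrobDist f₁ (fun y => if y ∈ Δf then δf y else 0) := hf₁lip.restrict hf₁dep
  have hg₁lip' : IsLipBound suFrobDist g₁ (fun y => if y ∈ Δg then δg y else 0) := hg₁lip.restrict hg₁dep
  have hplip : IsLipBound suFrobDist (fun σ => f₁ σ * g₁ σ)
      (fun y => 2 * Real.sqrt N * Sf * (if y ∈ Δg then δg y else 0) + 2 * Real.sqrt N * Sg * (if y ∈ Δf then δf y else 0)) := by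
    refine ⟨fun y => add_nonneg (mul_nonneg hMf0 (hg₁lip'.nonneg y)) (mul_nonneg hMg0 (hf₁lip'.nonneg y)), fun y σ τ hστ => ?_⟩
    have h1 : |f₁ σ| * |g₁ σ - g₁ τ| ≤ 2 * Real.sqrt N * Sf * ((if y ∈ Δg then δg y else 0) * suFrobDist (σ y) (τ y)) :=
      (mul_le_mul_of_nonneg_left (hg₁lip'.le y σ τ hστ) (abs_nonneg _)).trans
        (mul_le_mul_of_nonneg_right (hMf σ) (mul_nonneg (hg₁lip'.nonneg y) (suFrobDist_nonneg _ _)))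
    have h2 : |f₁ σ - f₁ τ| * |g₁ τ| ≤ (if y ∈ Δf then δf y else 0) * suFrobDist (σ y) (τ y) * (2 * Real.sqrt N * Sg) :=
      (mul_le_mul_of_nonneg_left (hMg τ) (abs_nonneg _)).trans
        (mul_le_mul_of_nonneg_right (hf₁lip'.le y σ τ hστ) hMg0)
    calc |f₁ σ * g₁ σ - f₁ τ * g₁ τ| = |f₁ σ * (g₁ σ - g₁ τ) + (f₁ σ - f₁ τ) * g₁ τ| := by ring_nf
      _ ≤ |f₁ σ * (g₁ σ - g₁ τ)| + |(f₁ σ - f₁ τ) * g₁ τ| := abs_add_le _ _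
      _ = |f₁ σ| * |g₁ σ - g₁ τ| + |f₁ σ - f₁ τ| * |g₁ τ| := by rw [abs_mul, abs_mul]
      _ ≤ _ := add_le_add h1 h2
      _ = _ := by ring
  -- three applications of state stability
  have e1 := hstab hpm hpdep hMp hplip
  have e2 := hstab hf₁m hf₁dep hMf hf₁lip
  have e3 := hstab hg₁m hg₁dep hMg hg₁lip
  have hsum1 : ∑ y ∈ Δf ∪ Δg, (2 * Real.sqrt N * Sf * (if y ∈ Δg then δg y else 0) +
      2 * Real.sqrt N * Sg * (if y ∈ Δf then δf y else 0)) = 4 * Real.sqrt N * Sf * Sg := by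
    rw [sum_add_distrib, ← mul_sum, ← mul_sum, Finset.sum_ite_mem, Finset.sum_ite_mem, Finset.union_inter_cancel_right,
      Finset.union_inter_cancel_left, ← hSf, ← hSg]
    ring
  rw [hsum1] at e1
  rw [← hSf] at e2
  rw [← hSg] at e3
  -- the covariance in terms of the centred observables
  have hcov : ∀ (ν : Measure (LGConfig d (SUN N))), IsProbabilityMeasure ν →
      cov[f, g; ν] = (∫ σ, f₁ σ * g₁ σ ∂ν) - (∫ σ, f₁ σ ∂ν) * ∫ σ, g₁ σ ∂ν := by
    intro ν hν
    have hf2 : MemLp f₁ 2 ν := MemLp.of_bound hf₁m.aestronglyMeasurable _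
      (Filter.Eventually.of_forall fun σ => by rw [Real.norm_eq_abs]; exact hMf σ)
    have hg2 : MemLp g₁ 2 ν := MemLp.of_bound hg₁m.aestronglyMeasurable _
      (Filter.Eventually.of_forall fun σ => by rw [Real.norm_eq_abs]; exact hMg σ)
    have hfi : Integrable f ν := by
      have hf' : f = fun σ => f₁ σ + f 1 := funext fun σ => by simp [hf₁]
      rw [hf']; exact (hf2.integrable one_le_two).add (integrable_const _)
    have hgi : Integrable g ν := by
      have hg' : g = fun σ => g₁ σ + g 1 := funext fun σ => by simp [hg₁]
      rw [hg']; exact (hg2.integrable one_le_two).add (integrable_const _)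
    rw [← covariance_sub_const_left hfi (f 1), ← covariance_sub_const_right hgi (g 1), ← hf₁, ← hg₁, covariance_eq_sub hf2 hg2]
    rfl
  rw [hcov μ' inferInstance, hcov μ inferInstance]
  have hA : |∫ σ, f₁ σ ∂μ'| ≤ 2 * Real.sqrt N * Sf := habsint μ' hMf
  have hB : |∫ σ, g₁ σ ∂μ| ≤ 2 * Real.sqrt N * Sg := habsint μ hMg
  have hCs0 : 0 ≤ Cs := by
    rw [hCs]; exact mul_nonneg (div_nonneg (by positivity) h1ρ.le) (mul_nonneg (by norm_num) hm0)
  have hNN : Real.sqrt N * Real.sqrt N = N := Real.mul_self_sqrt (Nat.cast_nonneg N)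
  calc |(∫ σ, f₁ σ * g₁ σ ∂μ') - (∫ σ, f₁ σ ∂μ') * (∫ σ, g₁ σ ∂μ') -
        ((∫ σ, f₁ σ * g₁ σ ∂μ) - (∫ σ, f₁ σ ∂μ) * ∫ σ, g₁ σ ∂μ)|
      = |((∫ σ, f₁ σ * g₁ σ ∂μ') - ∫ σ, f₁ σ * g₁ σ ∂μ) -
          ((∫ σ, f₁ σ ∂μ') * ((∫ σ, g₁ σ ∂μ') - ∫ σ, g₁ σ ∂μ) + ((∫ σ, f₁ σ ∂μ') - ∫ σ, f₁ σ ∂μ) * ∫ σ, g₁ σ ∂μ)| := by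
        ring_nf
    _ ≤ |(∫ σ, f₁ σ * g₁ σ ∂μ') - ∫ σ, f₁ σ * g₁ σ ∂μ| +
          |(∫ σ, f₁ σ ∂μ') * ((∫ σ, g₁ σ ∂μ') - ∫ σ, g₁ σ ∂μ) + ((∫ σ, f₁ σ ∂μ') - ∫ σ, f₁ σ ∂μ) * ∫ σ, g₁ σ ∂μ| :=
        abs_sub _ _
    _ ≤ |(∫ σ, f₁ σ * g₁ σ ∂μ') - ∫ σ, f₁ σ * g₁ σ ∂μ| +
          (|∫ σ, f₁ σ ∂μ'| * |(∫ σ, g₁ σ ∂μ') - ∫ σ, g₁ σ ∂μ| + |(∫ σ, f₁ σ ∂μ') - ∫ σ, f₁ σ ∂μ| * |∫ σ, g₁ σ ∂μ|) := by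
        gcongr
        exact (abs_add_le _ _).trans (by rw [abs_mul, abs_mul])
    _ ≤ Cs * (4 * Real.sqrt N * Sf * Sg) +
          (2 * Real.sqrt N * Sf * (Cs * Sg) +
            Cs * Sf * (2 * Real.sqrt N * Sg)) := by
        rw [abs_sub_comm] at e1 e2 e3
        exact add_le_add e1 (add_le_add (mul_le_mul hA e3 (abs_nonneg _) hMf0)
          (mul_le_mul e2 hB (abs_nonneg _) (mul_nonneg hCs0 hSf0)))
    _ = 32 * (Real.sqrt N * Real.sqrt N) * (min (Real.exp B - 1) 2 / (1 - ρ)) * Sf * Sg := by rw [hCs]; ring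
    _ = 32 * N * (min (Real.exp B - 1) 2 / (1 - ρ)) * Sf * Sg := by rw [hNN]
    _ = _ := by rw [hSf, hSg]

end Star

end Summit.Ventures.YMGap.RobustBall

end
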